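import Summits.BirchSwinnertonDyer.BirchSwinnertonDyer.Theorems.ManinLocalTwoThreeThreeShiftHeisenbergDescent
import Summits.BirchSwinnertonDyer.Rank1Residual.ManinAdditive.PrimePowerShiftGenerationLaws
import HarnessLib

/-!
# E-es-27 `ShiftInvariantHomIsDiamondThree` HOLDS (by name), from the PROVED E-es-96 `ThreeShiftInvariantIsDiamond`
# (route `ManinLocalTwoThree`, cell bsd-f2-manin; crux C3 `ManinPrimeToThreeAtNine` stmt-BirchSwinnertonDyer-22968; LEAD seat p1 gen 11)

The older es node E-es-27 (es g9, MEMO-es §21.4; leaf `…ManinAdditive.PrimePowerShiftGenerationLaws`): for `9 ∣ N`, every homomorphism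
`φ : Γ₀(N) →* Multiplicative (ℤ/3)` which is (i) parabolic and (ii) invariant under `γ ↦ A₃γA₃⁻¹` on `Γ₀(3N)` (entrywise form) is trivial on
`{d ≡ 1 (mod N)}`.  It is the `Multiplicative`-valued, parabolic-restricted phrasing of E-es-96 `NineShiftEqualiser.ThreeShiftInvariantIsDiamond`
(`K₃^grp(N) = D^grp(N)` for every `9 ∣ N`), which is a THEOREM of the tree (`threeShiftInvariantIsDiamond_holds`, sibling
`…ThreeShiftHeisenbergDescent.lean`, p683034 — joint p1/p2/p3, unconditional).  Translation (this file, sorry-free): `ψ := toAdd ∘ φ` is an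
additive `𝔽₃`-character; hypothesis (ii) at `γ = (a, b; 3c, d)`, `δ = (a, 3b; c, d)` is `IsThreeShiftInvariant ψ`; an element of `Γ₀(N)`
with `d ≡ 1 (mod N)` lies in `Γ₁(N)` (`a ≡ d⁻¹ ≡ 1`); the parabolicity hypothesis (i) is not even needed.
HONEST FRAMING: a by-name corollary; C3, Manin's conjecture and BSD are NOT proved by this.
[cite: DarmonDiamondTaylor1995, §4.3 (p. 120) (shape only; the law is the cell's E-es-27/E-es-96, now proved in the tree)]
-/

set_option autoImplicit false
set_option linter.dupNamespace false

open scoped MatrixGroups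

open CongruenceSubgroup Matrix.SpecialLinearGroup
  Summit.BirchSwinnertonDyer.Rank1Residual.ManinAdditive
  Summit.BirchSwinnertonDyer.Rank1Residual.ManinAdditive.NineShiftEqualiser

namespace Summit.BirchSwinnertonDyer.BirchSwinnertonDyer.Theorems.ManinLocalTwoThree

/-- An element of `Γ₀(N)` with `d ≡ 1 (mod N)` lies in `Γ₁(N)` (`a d ≡ 1`, so `a ≡ 1`). [folklore] -/
theorem mem_Gamma1_of_apply_one_one {N : ℕ} (γ : Gamma0 N) (hd : (((γ : SL(2, ℤ)) 1 1 : ℤ) : ZMod N) = 1) :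
    (γ : SL(2, ℤ)) ∈ Gamma1 N := by
  rw [Gamma1_mem]
  have hc : (((γ : SL(2, ℤ)) 1 0 : ℤ) : ZMod N) = 0 := Gamma0_mem.mp γ.2
  have hdet := congrArg (fun x : ℤ => (x : ZMod N)) (gamma0_det_entries γ)
  push_cast at hdet
  rw [hc, hd, mul_zero, sub_zero, mul_one] at hdet
  exact ⟨hdet, hd, hc⟩

/-- **E-es-27 `ShiftInvariantHomIsDiamondThree` HOLDS** — a corollary of the PROVED E-es-96 `threeShiftInvariantIsDiamond_holds`
(the parabolicity hypothesis is not used). [new: by-name corollary of the cell theorem E-es-96/E-es-94♯, MEMO-es §21.4 / §37] -/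
theorem shiftInvariantHomIsDiamondThree_holds : ShiftInvariantHomIsDiamondThree := by
  intro N h9 φ _ hshift γ hd
  -- the additive shadow `ψ = toAdd ∘ φ`
  set ψ : Gamma0 N → ZMod 3 := fun g => Multiplicative.toAdd (φ g) with hψ
  have hadd : IsAddChar ψ := by
    intro x y
    simp only [hψ, map_mul, toAdd_mul]
  have hinv : IsThreeShiftInvariant ψ := by
    intro a b c d hdet hc
    simp only [hψ]
    congr 1
    apply hshift (g0Of a b (3 * c) d hdet (Dvd.dvd.mul_left hc 3)) (g0Of a (3 * b) c d (by linear_combination hdet) hc)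
    · show (3 * (N : ℤ)) ∣ 3 * c
      exact mul_dvd_mul_left 3 hc
    · rfl
    · rfl
    · rfl
    · rfl
  have hdia : IsDiamondChar ψ := threeShiftInvariantIsDiamond_holds N h9 ψ hadd hinv
  have hmem : (γ : SL(2, ℤ)) ∈ Gamma1 N := mem_Gamma1_of_apply_one_one γ hd
  have h0 : ψ ⟨(γ : SL(2, ℤ)), Gamma1_in_Gamma0 N hmem⟩ = 0 := hdia (γ : SL(2, ℤ)) hmem
  have hγ : (⟨(γ : SL(2, ℤ)), Gamma1_in_Gamma0 N hmem⟩ : Gamma0 N) = γ := Subtype.ext rfl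
  rw [hγ] at h0
  simpa [hψ] using h0

end Summit.BirchSwinnertonDyer.BirchSwinnertonDyer.Theorems.ManinLocalTwoThree
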